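import Mathlib.InformationTheory.Hamming
import Mathlib.Data.ZMod.Basic
import Literature.InformationTheory.QuantumCodes.CSS
import HarnessLib

/-!
# Even-weight logical operators: an all-ones stabilizer product forces even weights (parity lemma)

The binary even-weight fact [MacWilliamsSloane1977, Ch. 1 §8 Problems (32), (34)]: for `u, v ∈ 𝔽₂ⁿ`,
`u · v = 0` iff `wt(u ∗ v)` is even; with `u = 𝟙` (all-ones): `𝟙 · v = 0 ⟺ wt(v)` even, i.e. the
dual of the repetition code `{0, 𝟙}` is the even-weight code.  Consequently, if `𝟙` lies in the row
space of a check matrix `H` — in particular if EVERY COLUMN of `H` has odd weight, for then the sum of all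
rows is `𝟙` — every `v ∈ ker H` has even Hamming weight (`even_hammingNorm_of_mulVec_eq_zero`,
`allOnes_vecMul_eq_allOnes`, `even_hammingNorm_of_mulVec_eq_zero_of_odd_cols`).

For a CSS code this makes every `Z`-logical candidate (`H^X v = 0`) even when `𝟙 ∈ rs H^X`, so `d^Z` is
even and a certified lower bound may skip the odd value below an even witness — kernels legitimately
enumerate only up to `wmax = d − 2` (`CSSCode.even_dZ_of_allOnes_mem_rowSpX`, `CSSCode.le_dZ_of_even`,
`CSSCode.dZ_eq_of_witness_of_even`, and `X` twins).  The two-block / bivariate-bicycle instances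
(odd `|supp a|`, `|supp b|`; the printed weight-3 side condition; `Even d`; pinned + parity certificate
forms) are in `BBEvenDistance.lean`.

Everything is PROVED; no definitions, no named facts.  (The checker-side Boolean form of the same step —
`parityOK` over `Nat` bitmask rows — is `Summits/Ventures/QEC/Census/CertParity.lean`; this file is the
matrix-level statement in `Mathlib` vocabulary, importable from `Literature`.)

## References
* [MacWilliamsSloane1977] F. J. MacWilliams, N. J. A. Sloane, *The Theory of Error-Correcting Codes*
  (North-Holland 1977), Ch. 1 §8, Problems (32) ("for binary vectors u · v = 0 iff wt(u ∗ v) is even …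
  u · u = 0 iff wt(u) is even") and (34) ("the dual of the [n, 1, n] binary repetition code is the
  [n, n − 1, 2] even weight code") (held text chunk p0032 L13, L25); Ch. 1 §9 (I) (chunk p0033 L9–16:
  adding an overall parity check makes all weights even, "the new minimum distance is d + 1" for odd d).
* [BravyiEtAl2024] S. Bravyi et al., *High-threshold and low-overhead fault-tolerant quantum memory*,
  Nature 627 (2024) = arXiv:2308.07915, §4 (chunk p0009 L23, L53–54: every qubit of a BB code meets
  three X-checks and three Z-checks — the motivating instance, see `BBEvenDistance.lean`).

## Mathlib / tree search (2026-08-26)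
Mathlib: `hammingNorm`, `Finset.natCast_card_filter`, `ZMod.natCast_eq_zero_iff_even`,
`ZMod.natCast_eq_one_iff_odd`.  Tree (reused, nothing redefined): `rowSpace`, `mem_rowSpace_of_vecMul_eq`,
`dotProduct_eq_zero_of_mem_rowSpace`, `CSSCode.dZ/dX/le_dZ/dZ_le_hammingNorm/exists_hammingNorm_eq_dZ/
dZ_pos_iff/dZ_swap` (`CSS.lean`).  `lean search "Even (hammingNorm"`: only the checker-side
`Census/CertParity.lean` (type-06; `Summits`, not importable from `Literature`; its vector lemma is
stated for `rowMatrix n Hsyn`, the one here for any `Matrix R Q (ZMod 2)` / `CSSCode`).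
-/

namespace Literature.InformationTheory.QuantumCodes

open Matrix

/-! ### The binary parity identity and the even-weight lemma for a check matrix -/

section Parity

variable {R Q : Type*} [Fintype Q]

/-- Over `𝔽₂` the Hamming weight read mod 2 is the sum of the coordinates: `|x| = Σᵢ xᵢ (mod 2)`
(`= x · x = 𝟙 · x`). [cite: MacWilliamsSloane1977, Ch. 1 §8 Problem (32) ("u · u = 0 iff wt(u) is even"; chunk p0032 L13)] -/
theorem natCast_hammingNorm_eq_sum (x : Q → ZMod 2) : (hammingNorm x : ZMod 2) = ∑ i, x i := by
  classical
  unfold hammingNorm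
  rw [Finset.natCast_card_filter]
  refine Finset.sum_congr rfl fun i _ => ?_
  have h2 : ∀ a : ZMod 2, (if a ≠ 0 then (1 : ZMod 2) else 0) = a := by decide
  convert h2 (x i)

/-- `𝟙 · x = |x| (mod 2)`. [cite: MacWilliamsSloane1977, Ch. 1 §8 Problem (32) ("for binary vectors u · v = 0 iff wt(u ∗ v) is even", with u = 𝟙; chunk p0032 L13)] -/
theorem dotProduct_allOnes_eq_natCast_hammingNorm (x : Q → ZMod 2) :
    x ⬝ᵥ (fun _ => (1 : ZMod 2)) = (hammingNorm x : ZMod 2) := by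
  rw [natCast_hammingNorm_eq_sum]
  simp [dotProduct]

/-- **The even-weight code is the dual of the repetition code**: `𝟙 · x = 0 ⟺ |x|` is even.
[cite: MacWilliamsSloane1977, Ch. 1 §8 Problems (32), (34) ("the dual of the [n, 1, n] binary repetition code is the [n, n − 1, 2] even weight code"; chunk p0032 L13, L25)] -/
theorem dotProduct_allOnes_eq_zero_iff_even (x : Q → ZMod 2) :
    x ⬝ᵥ (fun _ => (1 : ZMod 2)) = 0 ↔ Even (hammingNorm x) := by
  rw [dotProduct_allOnes_eq_natCast_hammingNorm, ZMod.natCast_eq_zero_iff_even]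

variable [Fintype R]

/-- **Parity lemma (L7).** If the all-ones vector is a combination of the rows of `H`, every kernel
vector of `H` has even Hamming weight (`|x| ≡ 𝟙 · x = Σ_rows row · x = 0`).
[cite: MacWilliamsSloane1977, Ch. 1 §8 Problems (32), (34) (chunk p0032 L13, L25)] -/
theorem even_hammingNorm_of_mulVec_eq_zero {H : Matrix R Q (ZMod 2)}
    (h1 : (fun _ => (1 : ZMod 2)) ∈ rowSpace H) {x : Q → ZMod 2} (hx : H *ᵥ x = 0) :
    Even (hammingNorm x) :=
  (dotProduct_allOnes_eq_zero_iff_even x).1 (dotProduct_eq_zero_of_mem_rowSpace h1 hx)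

omit [Fintype Q] in
/-- The sum of all rows of `H`, coordinate `j`, is the weight of column `j` mod 2.
[cite: MacWilliamsSloane1977, Ch. 1 §8 Problem (32) (chunk p0032 L13)] -/
theorem allOnes_vecMul_apply (H : Matrix R Q (ZMod 2)) (j : Q) :
    ((fun _ => (1 : ZMod 2)) ᵥ* H) j = (hammingNorm (fun i => H i j) : ZMod 2) := by
  rw [natCast_hammingNorm_eq_sum]
  simp [vecMul, dotProduct]

omit [Fintype Q] in
/-- **Odd column weights put `𝟙` in the row space**: if every column of `H` has odd weight, the sum of
all rows of `H` is the all-ones vector. [cite: MacWilliamsSloane1977, Ch. 1 §8 Problems (32), (34) (chunk p0032 L13, L25)] [cite: BravyiEtAl2024, §4 (arXiv:2308.07915 chunk p0009 L23: "exactly three non-zero entries in each row and each column"; L53–54)] -/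
theorem allOnes_vecMul_eq_allOnes {H : Matrix R Q (ZMod 2)} (hodd : ∀ j, Odd (hammingNorm fun i => H i j)) :
    (fun _ => (1 : ZMod 2)) ᵥ* H = fun _ => 1 := by
  funext j
  rw [allOnes_vecMul_apply, ZMod.natCast_eq_one_iff_odd]
  exact hodd j

omit [Fintype Q] in
/-- Hence `𝟙 ∈ rs H` when all column weights are odd.
[cite: MacWilliamsSloane1977, Ch. 1 §8 Problems (32), (34) (chunk p0032 L13, L25)] -/
theorem allOnes_mem_rowSpace_of_odd_cols {H : Matrix R Q (ZMod 2)}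
    (hodd : ∀ j, Odd (hammingNorm fun i => H i j)) : (fun _ => (1 : ZMod 2)) ∈ rowSpace H :=
  mem_rowSpace_of_vecMul_eq _ (allOnes_vecMul_eq_allOnes hodd)

/-- **Parity lemma, column form**: if every column of `H` has odd weight then every `x` with `H x = 0`
has even weight. [cite: MacWilliamsSloane1977, Ch. 1 §8 Problems (32), (34) (chunk p0032 L13, L25)] -/
theorem even_hammingNorm_of_mulVec_eq_zero_of_odd_cols {H : Matrix R Q (ZMod 2)}
    (hodd : ∀ j, Odd (hammingNorm fun i => H i j)) {x : Q → ZMod 2} (hx : H *ᵥ x = 0) :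
    Even (hammingNorm x) :=
  even_hammingNorm_of_mulVec_eq_zero (allOnes_mem_rowSpace_of_odd_cols hodd) hx

/-- The arithmetic of the lift: an even `m` with `d − 1 ≤ m`, `d` even, satisfies `d ≤ m`.
[cite: MacWilliamsSloane1977, Ch. 1 §9 (I) ("the distance between every pair of codewords is now even. If the minimum distance … was odd, the new minimum distance is d+1"; chunk p0033 L16)] -/
theorem le_of_even_of_sub_one_le {d m : ℕ} (hd : Even d) (hm : Even m) (h : d - 1 ≤ m) : d ≤ m := by
  obtain ⟨s, rfl⟩ := hd
  obtain ⟨t, rfl⟩ := hm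
  omega

end Parity

/-! ### CSS codes: even `Z`- and `X`-distances and the lifted certificate -/

namespace CSSCode

variable {RX RZ Q : Type*} [Fintype Q] [Fintype RX] [Fintype RZ]

omit [Fintype RZ] in
/-- If `𝟙 ∈ rs H^X` then every `Z`-logical candidate `v` (`H^X v = 0`) has even weight.
[cite: MacWilliamsSloane1977, Ch. 1 §8 Problems (32), (34) (chunk p0032 L13, L25)] -/
theorem even_hammingNorm_of_allOnes_mem_rowSpX (C : CSSCode RX RZ Q)
    (h1 : (fun _ => (1 : ZMod 2)) ∈ C.rowSpX) {v : Q → ZMod 2} (hv : C.HX *ᵥ v = 0) :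
    Even (hammingNorm v) :=
  even_hammingNorm_of_mulVec_eq_zero h1 hv

omit [Fintype RX] in
/-- If `𝟙 ∈ rs H^Z` then every `X`-logical candidate has even weight.
[cite: MacWilliamsSloane1977, Ch. 1 §8 Problems (32), (34) (chunk p0032 L13, L25)] -/
theorem even_hammingNorm_of_allOnes_mem_rowSpZ (C : CSSCode RX RZ Q)
    (h1 : (fun _ => (1 : ZMod 2)) ∈ C.rowSpZ) {v : Q → ZMod 2} (hv : C.HZ *ᵥ v = 0) :
    Even (hammingNorm v) :=
  even_hammingNorm_of_mulVec_eq_zero h1 hv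

/-- **`d^Z` is even** when `𝟙 ∈ rs H^X` (unconditionally: the junk value `0` is even too).
[cite: MacWilliamsSloane1977, Ch. 1 §8 Problems (32), (34) (chunk p0032 L13, L25)] -/
theorem even_dZ_of_allOnes_mem_rowSpX (C : CSSCode RX RZ Q) (h1 : (fun _ => (1 : ZMod 2)) ∈ C.rowSpX) :
    Even C.dZ := by
  by_cases h0 : C.dZ = 0
  · rw [h0]; exact ⟨0, rfl⟩
  · obtain ⟨v, hv, -, hvd⟩ := C.exists_hammingNorm_eq_dZ (C.dZ_pos_iff.1 (Nat.pos_of_ne_zero h0))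
    rw [← hvd]
    exact C.even_hammingNorm_of_allOnes_mem_rowSpX h1 hv

/-- **`d^X` is even** when `𝟙 ∈ rs H^Z`. [cite: MacWilliamsSloane1977, Ch. 1 §8 Problems (32), (34) (chunk p0032 L13, L25)] -/
theorem even_dX_of_allOnes_mem_rowSpZ (C : CSSCode RX RZ Q) (h1 : (fun _ => (1 : ZMod 2)) ∈ C.rowSpZ) :
    Even C.dX := by
  rw [← dZ_swap]
  exact C.swap.even_dZ_of_allOnes_mem_rowSpX h1

/-- **Lift of a lower bound past the odd value**: if `𝟙 ∈ rs H^X`, `d` is even and `d − 1 ≤ d^Z`, then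
`d ≤ d^Z` — a certificate for an even distance `d` need only exclude `Z`-logicals of weight `≤ d − 2`.
[cite: MacWilliamsSloane1977, Ch. 1 §8 Problems (32), (34) and §9 (I) (chunk p0032 L13, L25; p0033 L16)] -/
theorem le_dZ_of_even (C : CSSCode RX RZ Q) (h1 : (fun _ => (1 : ZMod 2)) ∈ C.rowSpX) {d : ℕ}
    (hd : Even d) (h : d - 1 ≤ C.dZ) : d ≤ C.dZ :=
  le_of_even_of_sub_one_le hd (C.even_dZ_of_allOnes_mem_rowSpX h1) h

/-- `X`-side lift. [cite: MacWilliamsSloane1977, Ch. 1 §8 Problems (32), (34) and §9 (I) (chunk p0032 L13, L25; p0033 L16)] -/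
theorem le_dX_of_even (C : CSSCode RX RZ Q) (h1 : (fun _ => (1 : ZMod 2)) ∈ C.rowSpZ) {d : ℕ}
    (hd : Even d) (h : d - 1 ≤ C.dX) : d ≤ C.dX :=
  le_of_even_of_sub_one_le hd (C.even_dX_of_allOnes_mem_rowSpZ h1) h

/-- **Certificate lemma with parity, `Z` side**: `𝟙 ∈ rs H^X`, an explicit `Z`-logical `v` of weight `d`,
and "every `Z`-logical has weight `≥ d − 1`" give `d^Z = d` (the weight of `v` is automatically even).
[cite: MacWilliamsSloane1977, Ch. 1 §8 Problems (32), (34) (chunk p0032 L13, L25)] -/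
theorem dZ_eq_of_witness_of_even (C : CSSCode RX RZ Q) (h1 : (fun _ => (1 : ZMod 2)) ∈ C.rowSpX)
    {d : ℕ} {v : Q → ZMod 2} (hv : C.HX *ᵥ v = 0) (hv' : v ∉ C.rowSpZ) (hwt : hammingNorm v = d)
    (h : ∀ w : Q → ZMod 2, C.HX *ᵥ w = 0 → w ∉ C.rowSpZ → d - 1 ≤ hammingNorm w) : C.dZ = d :=
  le_antisymm (hwt ▸ C.dZ_le_hammingNorm hv hv')
    (C.le_dZ_of_even h1 (hwt ▸ C.even_hammingNorm_of_allOnes_mem_rowSpX h1 hv)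
      (C.le_dZ ⟨v, hv, hv'⟩ h))

/-- **Certificate lemma with parity, `X` side.**
[cite: MacWilliamsSloane1977, Ch. 1 §8 Problems (32), (34) (chunk p0032 L13, L25)] -/
theorem dX_eq_of_witness_of_even (C : CSSCode RX RZ Q) (h1 : (fun _ => (1 : ZMod 2)) ∈ C.rowSpZ)
    {d : ℕ} {v : Q → ZMod 2} (hv : C.HZ *ᵥ v = 0) (hv' : v ∉ C.rowSpX) (hwt : hammingNorm v = d)
    (h : ∀ w : Q → ZMod 2, C.HZ *ᵥ w = 0 → w ∉ C.rowSpX → d - 1 ≤ hammingNorm w) : C.dX = d := by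
  rw [← dZ_swap]
  exact C.swap.dZ_eq_of_witness_of_even h1 hv hv' hwt h

end CSSCode

end Literature.InformationTheory.QuantumCodes
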